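import Mathlib
import Summits.ValiantsHypothesis.ValiantsHypothesis.Theorems.GrenetZeonTwoDimCoefficientsDualUnipotentThinNumeratorGauge
import Summits.ValiantsHypothesis.ValiantsHypothesis.Theorems.GrenetZeonTwoDimCoefficientsDualUnipotentCentredNumerator
import Summits.ValiantsHypothesis.ValiantsHypothesis.Theorems.GrenetZeonTwoDimCoefficientsDualUnipotentPowerTrace

/-!
# Crux `GrenetZeon.TwoDimCoefficients` (stmt-ValiantsHypothesis-8062) / rung `DualUnipotentThreeHalves` (stmt-24318):
# the centred numerator in PENCIL and POWER-TRACE currency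

Part 1 (✓ `…DualUnipotentCentredNumerator`) showed in the adjugate currency that the one-sided gauge `B ↦ B + A·P` is exact
(`tr(adj A·B)` moves by the constant `c·tr P`) and that centring at a point `p` kills the pointwise term of the thin-numerator
bound: `rank Hess_p tr(adj A·B) ≤ 2·rank coeff(B − A·A(p)⁻¹·B(p))`.  This file says the same in the two currencies used by the
24318 / `slow_core` programme:

* PENCIL (resolvent) currency — `N` affine with `N^m = 0`, `M` affine, `R = Σ_{j<m} tr(N^j·M)`:
  `sum_trace_pow_mul_one_sub_mul` (`Σ_j tr(N^j·(1 − N)·X) = tr X`, telescoping), `resolvent_add_one_sub_mul`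
  (`R(M + (1 − N)·P) = R(M) + tr P`), and with the centring `P_p = −(Σ_j N(p)^j)·M(p)` (`map_eval_centred_pencil_eq_zero`):
  ★★ `rank_hess0_resolvent_le_two_rank_coeff_centred` —
  `rank Hess_p R ≤ 2·rank coeff(M + (1 − N)·P_p)`, and the linear parts of the centred numerator are
  `M_t + N_t·S_p`, `S_p = (Σ_j N(p)^j)·M(p) = (1 − N(p))⁻¹·M(p)` (`map_coeff_centred_pencil`).
* POWER-TRACE currency — the normal form ✓ `exists_powerTrace_of_dualUnipotentRepr` (`per_n = tr(N^n·E)`, `N` linear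
  `2m × 2m` with `N^{2m} = 0`, `E` constant, `tr(N^j·E) = 0` for `j ≠ n`): here `M = E` is CONSTANT, so `M_t = 0` and
  ★★★ `sq_le_two_rank_pencil_mul_of_dualUnipotentRepr` — `DualUnipotentRepr (k+3) m` ⟹ in that normal form, at the
  Mignon–Ressayre point `p₀`, `(k+3)² ≤ 2·rank [ (N_t·S_{p₀})_{lk} ]_{(l,k), t}`, `S_{p₀} = (Σ_{j<2m} N(p₀)^j)·E`:
  the pencil directions `N_t`, multiplied on the right by the single matrix `S_{p₀} = (1 − N(p₀))⁻¹E` (of rank `rank E`),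
  must span at least `n²/2` dimensions — equivalently at most `dim 𝒩 − n²/2` independent pencil directions annihilate the
  `rank E`-dimensional space `(1 − N(p₀))⁻¹(im E)`.

HONEST FRAMING: necessary conditions in the model; helper for an ASIDE crux; closes no stub — `stub_dualUnipotent`, 24318,
`stub_longMassSlowLawInv`, `VP ≠ VNP` untouched.  No definitions, no named facts, no sorry.
-/

noncomputable section

-- single-conjunct layout `Summits/ValiantsHypothesis/ValiantsHypothesis`: the duplicated namespace component is mandated
set_option linter.dupNamespace false

namespace Summit.ValiantsHypothesis.ValiantsHypothesis.Theorems.GrenetZeon.CentredNumerator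

open MvPolynomial Matrix
open Literature.Computability.AlgebraicComplexity
open Summit.ValiantsHypothesis.ValiantsHypothesis.Theorems.GrenetZeon.ThinNumerator
open Summit.ValiantsHypothesis.ValiantsHypothesis.Cruxes.TwoDimCoefficients.DimTwoCases
  (AffMat IsAffine isAffine_one_sub DualUnipotentRepr exists_powerTrace_of_dualUnipotentRepr perPoly_ne_C)

/-! ### §1 Pencil (resolvent) currency -/

section Pencil

variable {n m : ℕ}

/-- Telescoping: `Σ_{j<m} tr(N^j·((1 − N)·X)) = tr X` when `N^m = 0`. [folklore] -/
theorem sum_trace_pow_mul_one_sub_mul (N X : AffMat n m) (hnil : N ^ m = 0) :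
    ∑ j ∈ Finset.range m, (N ^ j * ((1 - N) * X)).trace = X.trace := by
  rw [← Matrix.trace_sum, ← Finset.sum_mul]
  simp only [← Matrix.mul_assoc]
  rw [geom_sum_mul_neg, hnil, sub_zero, Matrix.one_mul]

/-- **One-sided gauge, pencil currency.**  `R(M + (1 − N)·P) = R(M) + tr P` for a constant `P`
(`R(X) = Σ_{j<m} tr(N^j·X)`). [folklore] -/
theorem resolvent_add_one_sub_mul (N M : AffMat n m) (hnil : N ^ m = 0) (P : Matrix (Fin m) (Fin m) ℂ) :
    ∑ j ∈ Finset.range m, (N ^ j * (M + (1 - N) * P.map (C : ℂ → MvPolynomial (Fin n × Fin n) ℂ))).trace =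
      ∑ j ∈ Finset.range m, (N ^ j * M).trace + C P.trace := by
  simp only [Matrix.mul_add, Matrix.trace_add, Finset.sum_add_distrib]
  rw [sum_trace_pow_mul_one_sub_mul N _ hnil, trace_map_C]

/-- The Hessian of the resolvent trace is unchanged by the one-sided gauge. [folklore] -/
theorem hess0_transl_resolvent_add_one_sub_mul (N M : AffMat n m) (hnil : N ^ m = 0)
    (P : Matrix (Fin m) (Fin m) ℂ) (p : Fin n × Fin n → ℂ) :
    hess0 (transl p (∑ j ∈ Finset.range m,
        (N ^ j * (M + (1 - N) * P.map (C : ℂ → MvPolynomial (Fin n × Fin n) ℂ))).trace)) =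
      hess0 (transl p (∑ j ∈ Finset.range m, (N ^ j * M).trace)) := by
  rw [resolvent_add_one_sub_mul N M hnil P, map_add, transl_C, map_add,
    hess0_eq_zero_of_totalDegree_le_one (f := C P.trace) (by rw [totalDegree_C]; exact Nat.zero_le _), add_zero]

/-- The value `N(p)` of a pencil with `N^m = 0` satisfies `N(p)^m = 0`. [folklore] -/
theorem map_eval_pow_eq_zero (N : AffMat n m) (hnil : N ^ m = 0) (p : Fin n × Fin n → ℂ) :
    N.map (eval p) ^ m = 0 := by
  have e : N.map (eval p) = (eval p).mapMatrix N := rfl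
  rw [e, ← map_pow, hnil, map_zero]

/-- **Centring, pencil currency.**  With `P_p = −(Σ_{j<m} N(p)^j)·M(p)` the gauged numerator `M + (1 − N)·P_p` vanishes
at `p` (`(1 − N(p))·Σ_j N(p)^j = 1 − N(p)^m = 1`). [folklore] -/
theorem map_eval_centred_pencil_eq_zero (N M : AffMat n m) (hnil : N ^ m = 0) (p : Fin n × Fin n → ℂ) :
    (M + (1 - N) * (-((∑ j ∈ Finset.range m, N.map (eval p) ^ j) * M.map (eval p))).map
        (C : ℂ → MvPolynomial (Fin n × Fin n) ℂ)).map (eval p) = 0 := by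
  rw [map_eval_add_mul (1 - N) M _ p]
  have e : (1 - N).map (eval p) = 1 - N.map (eval p) := by
    have e' : ∀ X : AffMat n m, X.map (eval p) = (eval p).mapMatrix X := fun X => rfl
    rw [e', map_sub, map_one, ← e']
  rw [e, Matrix.mul_neg, ← Matrix.mul_assoc, mul_neg_geom_sum, map_eval_pow_eq_zero N hnil p, sub_zero,
    Matrix.one_mul, add_neg_cancel]

/-- The linear parts of the centred pencil numerator: `coeff_t(M + (1 − N)·P) = M_t − N_t·P`, i.e. with
`P = −S_p`: `M_t + N_t·S_p`. [folklore] -/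
theorem map_coeff_add_one_sub_mul (N M : AffMat n m) (P : Matrix (Fin m) (Fin m) ℂ) (t : Fin n × Fin n) :
    (M + (1 - N) * P.map (C : ℂ → MvPolynomial (Fin n × Fin n) ℂ)).map (coeff (Finsupp.single t 1)) =
      M.map (coeff (Finsupp.single t 1)) - N.map (coeff (Finsupp.single t 1)) * P := by
  rw [map_coeff_add_mul (1 - N) M P]
  have h1 : (1 : AffMat n m).map (coeff (Finsupp.single t 1)) = 0 := by
    ext l j
    rw [Matrix.map_apply, Matrix.one_apply, Matrix.zero_apply]
    split_ifs
    · rw [coeff_one, if_neg]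
      exact (Finsupp.single_ne_zero.mpr one_ne_zero).symm
    · exact coeff_zero _
  rw [Matrix.map_sub _ (fun a b => by simp only [coeff_sub]), h1, zero_sub, Matrix.neg_mul, sub_eq_add_neg]

/-- ★★ **Centred bound, pencil currency.**  For an affine pencil `N` with `N^m = 0` and an affine `M`, at every point
`p`: `rank Hess_p (Σ_{j<m} tr(N^j·M)) ≤ 2·rank coeff(M + (1 − N)·P_p)`, `P_p = −(Σ_j N(p)^j)·M(p)` — no pointwise term,
no factor `m`; the linear parts of the centred numerator are `M_t + N_t·S_p`, `S_p = (Σ_j N(p)^j)·M(p)`. [folklore] -/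
theorem rank_hess0_resolvent_le_two_rank_coeff_centred (N M : AffMat n m) (hN : IsAffine N) (hM : IsAffine M)
    (hnil : N ^ m = 0) (p : Fin n × Fin n → ℂ) :
    (hess0 (transl p (∑ j ∈ Finset.range m, (N ^ j * M).trace))).rank ≤
      2 * (Matrix.of fun (lk : Fin m × Fin m) (t : Fin n × Fin n) =>
        coeff (Finsupp.single t 1)
          ((M + (1 - N) * (-((∑ j ∈ Finset.range m, N.map (eval p) ^ j) * M.map (eval p))).map
            (C : ℂ → MvPolynomial (Fin n × Fin n) ℂ)) lk.1 lk.2)).rank := by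
  set P : Matrix (Fin m) (Fin m) ℂ := -((∑ j ∈ Finset.range m, N.map (eval p) ^ j) * M.map (eval p)) with hP
  have h := rank_hess0_transl_resolvent_le_numerator N (M + (1 - N) * P.map C) hN
    (isAffine_add_mul (1 - N) M (isAffine_one_sub N hN) hM P) hnil p
  rw [hess0_transl_resolvent_add_one_sub_mul N M hnil P p, hP, map_eval_centred_pencil_eq_zero N M hnil p,
    Matrix.rank_zero, mul_zero, mul_zero, zero_add] at h
  exact h

/-- ★★ **Same bound with the centred directions written out**: `rank Hess_p R ≤ 2·rank [ M_t + N_t·S_p ]`,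
`S_p = (Σ_{j<m} N(p)^j)·M(p)`. [folklore] -/
theorem rank_hess0_resolvent_le_two_rank_centred_dirs (N M : AffMat n m) (hN : IsAffine N) (hM : IsAffine M)
    (hnil : N ^ m = 0) (p : Fin n × Fin n → ℂ) :
    (hess0 (transl p (∑ j ∈ Finset.range m, (N ^ j * M).trace))).rank ≤
      2 * (Matrix.of fun (lk : Fin m × Fin m) (t : Fin n × Fin n) =>
        (M.map (coeff (Finsupp.single t 1)) +
          N.map (coeff (Finsupp.single t 1)) * ((∑ j ∈ Finset.range m, N.map (eval p) ^ j) * M.map (eval p)))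
          lk.1 lk.2).rank := by
  have h := rank_hess0_resolvent_le_two_rank_coeff_centred N M hN hM hnil p
  have e : (Matrix.of fun (lk : Fin m × Fin m) (t : Fin n × Fin n) =>
        coeff (Finsupp.single t 1)
          ((M + (1 - N) * (-((∑ j ∈ Finset.range m, N.map (eval p) ^ j) * M.map (eval p))).map
            (C : ℂ → MvPolynomial (Fin n × Fin n) ℂ)) lk.1 lk.2)) =
      Matrix.of fun (lk : Fin m × Fin m) (t : Fin n × Fin n) =>
        (M.map (coeff (Finsupp.single t 1)) +
          N.map (coeff (Finsupp.single t 1)) * ((∑ j ∈ Finset.range m, N.map (eval p) ^ j) * M.map (eval p)))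
          lk.1 lk.2 := by
    refine Matrix.ext fun lk t => ?_
    have hc := congr_fun (congr_fun (map_coeff_add_one_sub_mul N M
      (-((∑ j ∈ Finset.range m, N.map (eval p) ^ j) * M.map (eval p))) t) lk.1) lk.2
    rw [Matrix.map_apply] at hc
    rw [Matrix.of_apply, Matrix.of_apply, hc, Matrix.mul_neg, sub_neg_eq_add]
  rw [e] at h
  exact h

end Pencil

/-! ### §2 Power-trace currency: the per side in the normal form -/

section PowerTrace

variable {m : ℕ}

/-- ★★★ **Per side in the power-trace normal form.**  If `per_{k+3}` has a unipotent dual representation of size `m`,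
then in the power-trace normal form (`N` linear `2m × 2m`, `N^{2m} = 0`, `E` constant with `E² = 0`,
`per = tr(N^{k+3}·E)`, `tr(N^j·E) = 0` for `j ≠ k+3`), at the Mignon–Ressayre point `p₀`:
`(k+3)² ≤ 2·rank [ (N_t·S_{p₀})_{lk} ]`, `S_{p₀} = (Σ_{j<2m} N(p₀)^j)·E` — the pencil directions right-multiplied by the
single matrix `S_{p₀} = (1 − N(p₀))⁻¹·E` span at least `n²/2` dimensions. [folklore] -/
theorem sq_le_two_rank_pencil_mul_of_dualUnipotentRepr (k : ℕ) (hrep : DualUnipotentRepr (k + 3) m) :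
    ∃ (N : AffMat (k + 3) (m + m)) (E : Matrix (Fin (m + m)) (Fin (m + m)) ℂ),
      (∀ i j, (N i j).IsHomogeneous 1) ∧ N ^ (m + m) = 0 ∧ E * E = 0 ∧
      perPoly (Fin (k + 3)) ℂ = (N ^ (k + 3) * E.map C).trace ∧
      (∀ j : ℕ, j ≠ k + 3 → (N ^ j * E.map C).trace = 0) ∧
      (k + 3) ^ 2 ≤ 2 * (Matrix.of fun (lk : Fin (m + m) × Fin (m + m)) (t : Fin (k + 3) × Fin (k + 3)) =>
        (N.map (coeff (Finsupp.single t 1)) *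
          ((∑ j ∈ Finset.range (m + m), N.map (eval (mrPoint ℂ k)) ^ j) * E)) lk.1 lk.2).rank := by
  obtain ⟨N, E, hhom, hnil, hE, hper, hcon⟩ := exists_powerTrace_of_dualUnipotentRepr (by omega) hrep
  refine ⟨N, E, hhom, hnil, hE, hper, hcon, ?_⟩
  have hN : IsAffine N := fun i j => (hhom i j).totalDegree_le
  set M : AffMat (k + 3) (m + m) := E.map C with hM
  have hMaff : IsAffine M := fun i j => by
    rw [hM, Matrix.map_apply, totalDegree_C]; exact Nat.zero_le _
  -- the resolvent trace of `(N, E)` IS the permanent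
  have hlt : k + 3 < m + m := by
    by_contra hge
    rw [not_lt] at hge
    apply perPoly_ne_C (n := k + 3) (by omega) 0
    rw [hper, pow_eq_zero_of_le hge hnil, Matrix.zero_mul, Matrix.trace_zero, map_zero]
  have hR : ∑ j ∈ Finset.range (m + m), (N ^ j * M).trace = perPoly (Fin (k + 3)) ℂ := by
    rw [hper, hM, Finset.sum_eq_single (k + 3) (fun j _ hj => hcon j hj)
      (fun h => absurd (Finset.mem_range.mpr hlt) h)]
  -- Hessian rank `n²` at the MR point
  have hrank : (hess0 (transl (mrPoint ℂ k) (∑ j ∈ Finset.range (m + m), (N ^ j * M).trace))).rank =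
      (k + 3) ^ 2 := by
    rw [hR, hess0_transl_mrPoint_perPoly, rank_smul_eq (by exact_mod_cast Nat.factorial_ne_zero k), rank_mrHess]
  have h := rank_hess0_resolvent_le_two_rank_centred_dirs N M hN hMaff hnil (mrPoint ℂ k)
  rw [hrank] at h
  -- `M = E` is constant: `M_t = 0`, `M(p₀) = E`
  have hMt : ∀ t : Fin (k + 3) × Fin (k + 3), M.map (coeff (Finsupp.single t 1)) = 0 := fun t => by
    ext l j
    rw [hM, Matrix.map_apply, Matrix.map_apply, coeff_C, if_neg, Matrix.zero_apply]
    exact (Finsupp.single_ne_zero.mpr one_ne_zero).symm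
  have hMp : M.map (eval (mrPoint ℂ k)) = E := by
    rw [hM, Matrix.map_map]
    have hc : (⇑(eval (mrPoint ℂ k)) ∘ (C : ℂ → MvPolynomial (Fin (k + 3) × Fin (k + 3)) ℂ)) = id :=
      funext fun x => by simp
    rw [hc, Matrix.map_id]
  have e : (Matrix.of fun (lk : Fin (m + m) × Fin (m + m)) (t : Fin (k + 3) × Fin (k + 3)) =>
        (M.map (coeff (Finsupp.single t 1)) +
          N.map (coeff (Finsupp.single t 1)) *
            ((∑ j ∈ Finset.range (m + m), N.map (eval (mrPoint ℂ k)) ^ j) * M.map (eval (mrPoint ℂ k))))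
          lk.1 lk.2) =
      Matrix.of fun (lk : Fin (m + m) × Fin (m + m)) (t : Fin (k + 3) × Fin (k + 3)) =>
        (N.map (coeff (Finsupp.single t 1)) *
          ((∑ j ∈ Finset.range (m + m), N.map (eval (mrPoint ℂ k)) ^ j) * E)) lk.1 lk.2 := by
    refine Matrix.ext fun lk t => ?_
    rw [Matrix.of_apply, Matrix.of_apply, hMt t, zero_add, hMp]
  rw [e] at h
  exact h

end PowerTrace

end Summit.ValiantsHypothesis.ValiantsHypothesis.Theorems.GrenetZeon.CentredNumerator

end
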